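import Summits.QuantumFields.BalabanUV.Beta.GAN24.PushSumNest
import Literature.MathematicalPhysics.QuantumFieldTheory.Balaban1983to89.Beta.DecLiftAdjoint

/-!
# `BalabanUV.Beta.GAN24.ScaleNesting` — binder row G-an2-4 / (CONV-C), S-slot («E3Shape» ∧ «E3SupRate»): generic leaf «DILATE*» of
# `HOME/b2b-balaban-gan24-p1/SKELETON-S3.md` v1.0 §13.2 (c), part 1 — NESTING AND COMMUTATION OF THE THREE SCALE MAPS
# (`avgLift`, `dec`, `pushSum`) across two blockings `P` and `P·Q`

NOT IN PRINT; OUR BOOKKEEPING.  HONEST FRAMING (cell contract, verbatim): «discharging `BetaPertH` makes Bałaban's UV stability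
UNCONDITIONAL — a real constructive-QFT result; it is NOT the continuum limit and NOT the Clay problem.»  HONEST DEPENDENCY (verbatim):
«continuum YM on T⁴ ⇐ BetaPertH ∧ nine spine estimates (0/9 proved); BetaPertH ⇐ (D1) ∧ (D4) ∧ CAP+tail; G-an2-4 gates asym, D1 and
NE2/3/4.»  [folklore] finite-sum algebra over an2's TYPED scale maps — the averaging lift `InterLevelTransport.avgLift` (`Q′ᵀ · Q′`),
the block-contour decimation `OneStepKernelFamily.dec` (`Q′ · Q′ᵀ`) and the one-step push of the multiplier legs
`BalabanCompositeJets.pushSum` — BY NAME, nothing redefined; NO estimate, NO cited fact, NO `def … : Prop`, NO wall binder, nothing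
asserted of Bałaban's objects; NO `def` at all (the combined leg index on FIELD legs is leaf-17's
`PushSumNest.combLeg` read through `Sum.swap`).  Leaf «DILATE*» of unit `b2b-balaban-gan24-formalise-leaf-05` (gen 18), opened to idle seats by the row owner
(gan24-p1-g4, cell journal RULINGS-5); the reserved family `GAN24.StencilSlotE3*` is untouched.  NOT summit progress; nothing of
(CONV-C)'s S-slot is discharged here.

## Why (locator, not a premise)
The RATE table of the S-slot (`SKELETON-S3.md` §13, `StencilSlotE3RateOfPieces.e3SupRate_of_pieces`) pairs the pieces of consecutive
members BY DEPTH: member `n+3`'s level-`(m+2)` border / Lagrange piece against member `n+2`'s level-`(m+1)` piece — «the SAME finite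
averaging tables one lattice scale apart».  Making that sentence a kernel identity needs the exact behaviour of the three scale maps
under `M ↦ P·M` (here), and then of the increments `borderInc` / `lagrInc` built from them (part 2, `GAN24/DilationCovariance`).

## What is proved (generic `d`; `P ≠ 0` where a block index by `P` is taken; no hypothesis on the other factors)
* §1 TWO-SCALE ARITHMETIC: `quo_mul` (`⌊x/(PQ)⌋ = ⌊⌊x/P⌋/Q⌋`), `proj_eq_zero_iff`, **`proj_mul_eq_zero_iff`** (`x ∈ (PQ)•ℤ ⇔ x ∈ P•ℤ ∧
  ⌊x/P⌋ ∈ Q•ℤ`), `legW_mul`, `sum_legSet_mul` (re-indexing `legSet d (P·Q) a` as `legSet d Q a × legSet d P a` through the combined index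
  `combLeg P a.swap`, `PushSumNest.sum_LegIdx_mul` on field legs), `legOff_combLeg`, `legPt_combLeg`
  (`PushSumNest.legPt_legPt` on field legs), and the per-leg two-scale condition/index `twoScale_leg`.
* §2 **`avgLift_avgLift : avgLift P (avgLift Q G) = avgLift (P·Q) G`** — lifts nest (block-contour averages compose; the `avgLift`
  twin of `PushSumNest.pushSum_pushSum`).
* §3 **`dec_dec : dec P (dec M K) = dec (M·P) K`** — decimations nest (the `dec` twin).
* §4 **`pushSum_avgLift : pushSum (P·M) L (avgLift P K) = avgLift P (pushSum M L K)`** — the push of the multiplier legs COMMUTES with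
  the lift at consistent scales (per-leg facts `pushInd_lift`, `quo_pushPt_lift`).
Primed variants (`avgLift_avgLift'`, `dec_dec'`, `pushSum_avgLift'`) take the scale product as an equation (for powers of `Lc`).
No analysis (finite sums only).  Consumers: `GAN24/DilationCovariance` (part 2: `borderInc` / `lagrInc`), the RATE rows dV/dL/dVt/dLt.
-/

noncomputable section

open Finset
open scoped BigOperators
open Literature.MathematicalPhysics.QuantumFieldTheory
open Literature.MathematicalPhysics.QuantumFieldTheory.Balaban1983to89
open Literature.MathematicalPhysics.QuantumFieldTheory.Balaban1983to89.Beta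
open Literature.Probability.LatticeModels (Torus.proj Torus.proj_apply)
open LatticeForm (quo proj_add_zsmul)
open BlochFibreUniqueness (quo_add_zsmul)
open ExpKernelCalculus (MKer)
open OneStepResolventKernel (Fib proj_zsmul quo_zsmul)
open OneStepKernelFamily (legSet legPt legW LegIdx dec)
open InterLevelTransport (avgLift legOff legPt_eq_add_legOff)
open BalabanCompositeJets (pushSet pushPt pushInd pushSum)
open Summit.QuantumFields.BalabanUV.Beta.GAN24.PushSumNest (comb combLeg sum_LegIdx_mul legPt_legPt)

namespace Summit.QuantumFields.BalabanUV.Beta.GAN24.ScaleNesting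

variable {d : ℕ}

/-! ## §1 Two-scale arithmetic: block indices, sublattice conditions, leg weights and leg offsets across `P` and `P·Q` -/

section TwoScale

/-- [folklore] Block indices compose: the `(P·Q)`-block index is the `Q`-block index of the `P`-block index
(`⌊x/(PQ)⌋ = ⌊⌊x/P⌋/Q⌋` coordinatewise). -/
theorem quo_mul (P Q : ℕ) (x : Fin (d + 1) → ℤ) : quo (P * Q) x = quo Q (quo P x) := by
  funext j
  simp only [quo, Nat.cast_mul]
  exact (Int.ediv_ediv_of_nonneg (Int.natCast_nonneg P)).symm

/-- [folklore] A point lies on the sublattice `N•ℤ^{d+1}` iff `N` divides every coordinate. -/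
theorem proj_eq_zero_iff (N : ℕ) (x : Fin (d + 1) → ℤ) : Torus.proj N x = 0 ↔ ∀ j, (N : ℤ) ∣ x j := by
  refine ⟨fun h j => ?_, fun h => funext fun j => ?_⟩
  · have hj := congrFun h j
    rw [Torus.proj_apply, Pi.zero_apply, ← Int.cast_zero, ZMod.intCast_eq_intCast_iff_dvd_sub] at hj
    simpa using hj
  · rw [Torus.proj_apply, Pi.zero_apply, ← Int.cast_zero, ZMod.intCast_eq_intCast_iff_dvd_sub]
    simpa using h j

/-- [folklore] **TWO-SCALE SUBLATTICE CONDITION**: `x ∈ (P·Q)•ℤ^{d+1}` iff `x ∈ P•ℤ^{d+1}` and its `P`-block index lies in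
`Q•ℤ^{d+1}` (`P ≠ 0`). -/
theorem proj_mul_eq_zero_iff (P Q : ℕ) [NeZero P] (x : Fin (d + 1) → ℤ) :
    Torus.proj (P * Q) x = 0 ↔ Torus.proj P x = 0 ∧ Torus.proj Q (quo P x) = 0 := by
  have hP : (P : ℤ) ≠ 0 := by exact_mod_cast NeZero.ne P
  simp only [proj_eq_zero_iff, quo, Nat.cast_mul, ← forall_and]
  refine forall_congr' fun j => ⟨fun h => ?_, fun h => ?_⟩
  · obtain ⟨k, hk⟩ := h
    refine ⟨⟨Q * k, by rw [hk, mul_assoc]⟩, ⟨k, ?_⟩⟩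
    rw [hk, mul_assoc, Int.mul_ediv_cancel_left _ hP]
  · obtain ⟨⟨k, hk⟩, ⟨k', hk'⟩⟩ := h
    refine ⟨k', ?_⟩
    rw [hk, Int.mul_ediv_cancel_left _ hP] at hk'
    rw [hk, hk', mul_assoc]

/-- [folklore] Leg weights are multiplicative across scales: `(PQ)^{−(d+2)} = P^{−(d+2)}·Q^{−(d+2)}` on a field leg, `1 = 1·1`
on a multiplier leg. -/
theorem legW_mul (P Q : ℕ) (a : Fib d) : legW d (P * Q) a = legW d P a * legW d Q a := by
  rcases a with κ | μ
  · simp only [legW, Nat.cast_mul, mul_pow, mul_inv]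
  · simp only [legW, mul_one]

/-- [folklore] **RE-INDEXING OF THE LEG INDEX SETS ACROSS SCALES**: a sum over `legSet d (P·Q) a` is the double sum over
`legSet d Q a` (outer, coarser) and `legSet d P a` (inner, finer) of the COMBINED indices `combLeg P a.swap j i` — leaf-17's
`PushSumNest.combLeg` read through `Sum.swap`, i.e. `PushSumNest.comb P j i` on a FIELD leg and the unique index on a multiplier leg
(`PushSumNest.sum_LegIdx_mul` on a field leg; trivial on a multiplier leg; no new definition). -/
theorem sum_legSet_mul {E : Type*} [AddCommMonoid E] (P Q : ℕ) (a : Fib d) (f : (Fin (d + 1) → ℕ) × ℕ → E) :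
    ∑ k ∈ legSet d (P * Q) a, f k = ∑ j ∈ legSet d Q a, ∑ i ∈ legSet d P a, f (combLeg P (Sum.swap a) j i) := by
  rcases a with κ | μ
  · exact sum_LegIdx_mul P Q f
  · simp only [legSet, combLeg, Sum.swap_inr, Finset.sum_singleton]

/-- [folklore] **NESTED LEG OFFSETS**: the offset of the combined index is `P` times the coarse offset plus the fine offset. -/
theorem legOff_combLeg (P Q : ℕ) (a : Fib d) (j i : (Fin (d + 1) → ℕ) × ℕ) :
    legOff (P * Q) a (combLeg P (Sum.swap a) j i) = (P : ℤ) • legOff Q a j + legOff P a i := by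
  rcases a with κ | μ
  · show legPt (P * Q) (Sum.inl κ : Fib d) 0 (comb P j i) = (P : ℤ) • legPt Q (Sum.inl κ : Fib d) 0 j + legOff P (Sum.inl κ) i
    rw [← legPt_legPt, legPt_eq_add_legOff]
  · simp only [legOff, legPt, smul_zero, add_zero]

/-- [folklore] **NESTED LEG POINTS** (both leg types): the `P`-leg point (index `i`) over the `Q`-leg point (index `j`) over `z` is
the `(P·Q)`-leg point over `z` with the combined index. -/
theorem legPt_combLeg (P Q : ℕ) (a : Fib d) (z : Fin (d + 1) → ℤ) (j i : (Fin (d + 1) → ℕ) × ℕ) :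
    legPt P a (legPt Q a z j) i = legPt (P * Q) a z (combLeg P (Sum.swap a) j i) := by
  rcases a with κ | μ
  · exact legPt_legPt P Q κ z j i
  · simp only [legPt, smul_smul, Nat.cast_mul]

/-- [folklore] **THE TWO-SCALE LEG CONDITION AND BLOCK INDEX**: for the combined index, the `(P·Q)`-lift condition at the fine
point `x` is the `P`-lift condition at `x` together with the `Q`-lift condition at the `P`-block index, and the `(P·Q)`-block
index is the `Q`-block index of the shifted `P`-block index. -/
theorem twoScale_leg (P Q : ℕ) [NeZero P] (a : Fib d) (x : Fin (d + 1) → ℤ) (j i : (Fin (d + 1) → ℕ) × ℕ) :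
    (Torus.proj (P * Q) (x - legOff (P * Q) a (combLeg P (Sum.swap a) j i)) = 0 ↔
        Torus.proj P (x - legOff P a i) = 0 ∧ Torus.proj Q (quo P (x - legOff P a i) - legOff Q a j) = 0) ∧
      quo (P * Q) (x - legOff (P * Q) a (combLeg P (Sum.swap a) j i)) = quo Q (quo P (x - legOff P a i) - legOff Q a j) := by
  have e : x - legOff (P * Q) a (combLeg P (Sum.swap a) j i) = (x - legOff P a i) + (P : ℤ) • (-legOff Q a j) := by
    rw [legOff_combLeg, smul_neg]; abel
  rw [e, proj_mul_eq_zero_iff, proj_add_zsmul, quo_mul, quo_add_zsmul, ← sub_eq_add_neg]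
  exact ⟨Iff.rfl, rfl⟩

end TwoScale

/-! ## §2 Nesting of averaging lifts: `avgLift P ∘ avgLift Q = avgLift (P·Q)` (`Q′ᵀ_{PQ} = Q′ᵀ_P ∘ Q′ᵀ_Q`) -/

section LiftNest

/-- [folklore] **NESTING OF AVERAGING LIFTS** (the `avgLift` twin of `PushSumNest.pushSum_pushSum`; «block-contour averages
compose», [Balaban1984PropagatorsI (1.16)–(1.17)] names the mechanism, nothing printed is asserted): lifting a kernel from the
`(P·Q)`-times coarser lattice to the `P`-times coarser lattice (factor `Q`) and then to the fine lattice (factor `P`) IS the single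
lift by `P·Q` — for EVERY kernel and ALL legs (`P ≠ 0`; no hypothesis on `Q`). -/
theorem avgLift_avgLift (P Q : ℕ) [NeZero P] (G : MKer (d + 1) (Fib d)) :
    avgLift P (avgLift Q G) = avgLift (P * Q) G := by
  classical
  funext x w a b
  -- the common summand, indexed by (fine index, fine index', coarse index, coarse index')
  set F : ((Fin (d + 1) → ℕ) × ℕ) → ((Fin (d + 1) → ℕ) × ℕ) → ((Fin (d + 1) → ℕ) × ℕ) → ((Fin (d + 1) → ℕ) × ℕ) → ℝ :=
    fun i i' j j' => legW d (P * Q) a * legW d (P * Q) b *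
      (if Torus.proj (P * Q) (x - legOff (P * Q) a (combLeg P (Sum.swap a) j i)) = 0 ∧
          Torus.proj (P * Q) (w - legOff (P * Q) b (combLeg P (Sum.swap b) j' i')) = 0 then
        G (quo (P * Q) (x - legOff (P * Q) a (combLeg P (Sum.swap a) j i)))
          (quo (P * Q) (w - legOff (P * Q) b (combLeg P (Sum.swap b) j' i'))) a b
      else 0) with hF
  have key : ∀ (i i' j j' : (Fin (d + 1) → ℕ) × ℕ),
      legW d P a * legW d P b *
          (if Torus.proj P (x - legOff P a i) = 0 ∧ Torus.proj P (w - legOff P b i') = 0 then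
            legW d Q a * legW d Q b *
              (if Torus.proj Q (quo P (x - legOff P a i) - legOff Q a j) = 0 ∧
                  Torus.proj Q (quo P (w - legOff P b i') - legOff Q b j') = 0 then
                G (quo Q (quo P (x - legOff P a i) - legOff Q a j)) (quo Q (quo P (w - legOff P b i') - legOff Q b j')) a b
              else 0)
          else 0) = F i i' j j' := by
    intro i i' j j'
    obtain ⟨h1, h2⟩ := twoScale_leg P Q a x j i
    obtain ⟨h3, h4⟩ := twoScale_leg P Q b w j' i'
    simp only [hF]
    rw [h2, h4, legW_mul, legW_mul]
    simp only [h1, h3]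
    by_cases hx : Torus.proj P (x - legOff P a i) = 0
    · by_cases hw : Torus.proj P (w - legOff P b i') = 0
      · simp only [hx, hw, true_and, and_self, if_true]
        split_ifs <;> ring
      · simp only [hw, false_and, and_false, if_false, mul_zero]
    · simp only [hx, false_and, if_false, mul_zero]
  -- LHS = Σ_i Σ_i' Σ_j Σ_j' F
  have hL : avgLift P (avgLift Q G) x w a b =
      ∑ i ∈ legSet d P a, ∑ i' ∈ legSet d P b, ∑ j ∈ legSet d Q a, ∑ j' ∈ legSet d Q b, F i i' j j' := by
    simp only [avgLift]
    refine Finset.sum_congr rfl fun i _ => Finset.sum_congr rfl fun i' _ => ?_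
    rw [← Finset.sum_congr rfl fun j _ => Finset.sum_congr rfl fun j' _ => key i i' j j']
    split_ifs with h
    · rw [Finset.mul_sum]
      refine Finset.sum_congr rfl fun j _ => ?_
      rw [Finset.mul_sum]
    · simp only [mul_zero, Finset.sum_const_zero]
  -- RHS = Σ_j Σ_i Σ_j' Σ_i' F
  have hR : avgLift (P * Q) G x w a b =
      ∑ j ∈ legSet d Q a, ∑ i ∈ legSet d P a, ∑ j' ∈ legSet d Q b, ∑ i' ∈ legSet d P b, F i i' j j' := by
    simp only [avgLift, hF]
    rw [sum_legSet_mul P Q a]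
    refine Finset.sum_congr rfl fun j _ => Finset.sum_congr rfl fun i _ => ?_
    rw [sum_legSet_mul P Q b]
  rw [hL, hR]
  calc ∑ i ∈ legSet d P a, ∑ i' ∈ legSet d P b, ∑ j ∈ legSet d Q a, ∑ j' ∈ legSet d Q b, F i i' j j'
      = ∑ i ∈ legSet d P a, ∑ j ∈ legSet d Q a, ∑ j' ∈ legSet d Q b, ∑ i' ∈ legSet d P b, F i i' j j' := by
        refine Finset.sum_congr rfl fun i _ => ?_
        rw [Finset.sum_comm]
        refine Finset.sum_congr rfl fun j _ => ?_
        rw [Finset.sum_comm]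
    _ = _ := Finset.sum_comm

/-- [folklore] Nesting of lifts with the scale product supplied as an equation (the form used under powers of `Lc`). -/
theorem avgLift_avgLift' {P Q R : ℕ} [NeZero P] (hR : R = P * Q) (G : MKer (d + 1) (Fib d)) :
    avgLift P (avgLift Q G) = avgLift R G := by
  subst hR; exact avgLift_avgLift P Q G

end LiftNest

/-! ## §3 Nesting of block-contour decimations: `dec P ∘ dec M = dec (M·P)` (`Q′_{MP} = Q′_P ∘ Q′_M`) -/

section DecNest

/-- [folklore] **NESTING OF DECIMATIONS** (the `dec` twin of `PushSumNest.pushSum_pushSum` / `avgLift_avgLift`): decimating a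
fine kernel by `M` and the result by `P` IS the single decimation by `M·P` — for EVERY kernel and ALL legs (no hypothesis on
`M`, `P`).  With `hessKer_avgLift` / `dec_comp_avgLift_comp` (an2/an4, BY NAME) this is what turns two stacked lifts of vertices
into one decimated covariance. -/
theorem dec_dec (M P : ℕ) (K : MKer (d + 1) (Fib d)) : dec P (dec M K) = dec (M * P) K := by
  funext x' y' a b
  simp only [dec]
  rw [sum_legSet_mul M P a]
  refine Finset.sum_congr rfl fun j _ => ?_
  calc ∑ j' ∈ legSet d P b, legW d P a * legW d P b *
          ∑ i ∈ legSet d M a, ∑ i' ∈ legSet d M b,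
            legW d M a * legW d M b * K (legPt M a (legPt P a x' j) i) (legPt M b (legPt P b y' j') i') a b
      = ∑ j' ∈ legSet d P b, ∑ i ∈ legSet d M a, ∑ i' ∈ legSet d M b,
          legW d (M * P) a * legW d (M * P) b *
            K (legPt (M * P) a x' (combLeg M (Sum.swap a) j i)) (legPt (M * P) b y' (combLeg M (Sum.swap b) j' i')) a b := by
        refine Finset.sum_congr rfl fun j' _ => ?_
        rw [Finset.mul_sum]
        refine Finset.sum_congr rfl fun i _ => ?_
        rw [Finset.mul_sum]
        refine Finset.sum_congr rfl fun i' _ => ?_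
        rw [legPt_combLeg, legPt_combLeg, legW_mul, legW_mul]
        ring
    _ = _ := by
        rw [Finset.sum_comm]
        refine Finset.sum_congr rfl fun i _ => ?_
        rw [sum_legSet_mul M P b]

/-- [folklore] Nesting of decimations with the scale product supplied as an equation. -/
theorem dec_dec' {M P R : ℕ} (hR : R = M * P) (K : MKer (d + 1) (Fib d)) : dec P (dec M K) = dec R K := by
  subst hR; exact dec_dec M P K

end DecNest

/-! ## §4 The push of the multiplier legs COMMUTES with the averaging lift at consistent scales -/

section PushLift

/-- [folklore] `↑(P·M) • v = ↑P • (↑M • v)`. -/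
theorem natCast_mul_smul (P M : ℕ) (v : Fin (d + 1) → ℤ) : ((P * M : ℕ) : ℤ) • v = (P : ℤ) • ((M : ℤ) • v) := by
  rw [Nat.cast_mul, mul_smul]

variable (P M L : ℕ) [NeZero P]

/-- [folklore] `(if A ∧ A′ then v else 0) = 𝟙_A · 𝟙_{A′} · v`. -/
theorem ite_and_eq {A A' : Prop} [Decidable A] [Decidable A'] (v : ℝ) :
    (if A ∧ A' then v else 0) = (if A then (1 : ℝ) else 0) * (if A' then (1 : ℝ) else 0) * v := by
  by_cases hA : A <;> by_cases hA' : A' <;> simp [hA, hA']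

/-- [folklore] PER-LEG INDICATOR IDENTITY behind `pushSum_avgLift`: (push indicator at scale `P·M`) × (`P`-lift condition at the
pushed point) = (`P`-lift condition at the point) × (push indicator at scale `M` at the `P`-block index).  Field leg: all four are
`1`/the same condition; multiplier leg: `x ∈ (P·M·L)•ℤ ⇔ x ∈ P•ℤ ∧ ⌊x/P⌋ ∈ (M·L)•ℤ` (`proj_mul_eq_zero_iff`), the pushed point lying
on `P•ℤ` automatically. -/
theorem pushInd_lift (a : Fib d) (x : Fin (d + 1) → ℤ) (i k : (Fin (d + 1) → ℕ) × ℕ) :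
    pushInd (P * M) L a x * (if Torus.proj P (pushPt (P * M) L a x k - legOff P a i) = 0 then (1 : ℝ) else 0) =
      (if Torus.proj P (x - legOff P a i) = 0 then (1 : ℝ) else 0) * pushInd M L a (quo P (x - legOff P a i)) := by
  rcases a with α | μ
  · simp only [pushInd, pushPt, one_mul, mul_one]
    split_ifs <;> rfl
  · have h0 : legOff P (Sum.inr μ : Fib d) i = 0 := by simp only [legOff, legPt, smul_zero]
    rw [h0, sub_zero, sub_zero]
    have hin : Torus.proj P (pushPt (P * M) L (Sum.inr μ : Fib d) x k) = 0 := by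
      simp only [pushPt]
      rw [natCast_mul_smul, proj_zsmul]
    rw [if_pos hin, mul_one]
    have hiff : Torus.proj (P * M * L) x = 0 ↔ Torus.proj P x = 0 ∧ Torus.proj (M * L) (quo P x) = 0 := by
      rw [Nat.mul_assoc]; exact proj_mul_eq_zero_iff P (M * L) x
    by_cases h1 : Torus.proj P x = 0
    · by_cases h2 : Torus.proj (M * L) (quo P x) = 0
      · have h3 : Torus.proj (P * M * L) x = 0 := hiff.2 ⟨h1, h2⟩
        simp only [pushInd, h1, h2, h3, if_true, one_mul]
      · have h3 : ¬ Torus.proj (P * M * L) x = 0 := fun h => h2 (hiff.1 h).2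
        simp only [pushInd, h1, h2, h3, if_true, if_false, one_mul]
    · have h3 : ¬ Torus.proj (P * M * L) x = 0 := fun h => h1 (hiff.1 h).1
      simp only [pushInd, h1, h3, if_false, zero_mul]

/-- [folklore] PER-LEG POINT IDENTITY behind `pushSum_avgLift`: the `P`-block index of the (shifted) pushed point at scale `P·M` is
the pushed point at scale `M` of the `P`-block index (`⌊x/(PML)⌋ = ⌊⌊x/P⌋/(ML)⌋`). -/
theorem quo_pushPt_lift (a : Fib d) (x : Fin (d + 1) → ℤ) (i k : (Fin (d + 1) → ℕ) × ℕ) :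
    quo P (pushPt (P * M) L a x k - legOff P a i) = pushPt M L a (quo P (x - legOff P a i)) k := by
  rcases a with α | μ
  · simp only [pushPt]
  · have h0 : legOff P (Sum.inr μ : Fib d) i = 0 := by simp only [legOff, legPt, smul_zero]
    simp only [pushPt, h0, sub_zero]
    rw [natCast_mul_smul, quo_zsmul, ← quo_mul, Nat.mul_assoc]

/-- [folklore] **THE PUSH COMMUTES WITH THE LIFT**: pushing the multiplier legs (one more blocking by `L`) of a kernel LIFTED by `P`
from the `P`-times coarser lattice — whose multiplier legs therefore sit on `(P·M)•ℤ^{d+1}` — IS the lift by `P` of the push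
performed on the coarser lattice (multiplier legs on `M•ℤ^{d+1}` there): `pushSum (P·M) L ∘ avgLift P = avgLift P ∘ pushSum M L`.
The push acts on multiplier legs only, the lift reads multiplier legs at coarse points and averages field legs; the two
operations touch each leg compatibly (`pushInd_lift`, `quo_pushPt_lift`).  `P ≠ 0`; no hypothesis on `M`, `L`. -/
theorem pushSum_avgLift (K : MKer (d + 1) (Fib d)) :
    pushSum (P * M) L (avgLift P K) = avgLift P (pushSum M L K) := by
  classical
  funext x w a b
  -- the common summand, indexed by (lift index, lift index', push index, push index')
  set T : ((Fin (d + 1) → ℕ) × ℕ) → ((Fin (d + 1) → ℕ) × ℕ) → ((Fin (d + 1) → ℕ) × ℕ) → ((Fin (d + 1) → ℕ) × ℕ) → ℝ :=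
    fun i i' k k' => legW d P a * legW d P b *
      ((if Torus.proj P (x - legOff P a i) = 0 then (1 : ℝ) else 0) *
          (if Torus.proj P (w - legOff P b i') = 0 then (1 : ℝ) else 0) *
        (pushInd M L a (quo P (x - legOff P a i)) * pushInd M L b (quo P (w - legOff P b i')) *
          K (pushPt M L a (quo P (x - legOff P a i)) k) (pushPt M L b (quo P (w - legOff P b i')) k') a b)) with hT
  have key : ∀ (i i' k k' : (Fin (d + 1) → ℕ) × ℕ),
      pushInd (P * M) L a x * pushInd (P * M) L b w *
          (legW d P a * legW d P b *
            (if Torus.proj P (pushPt (P * M) L a x k - legOff P a i) = 0 ∧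
                Torus.proj P (pushPt (P * M) L b w k' - legOff P b i') = 0 then
              K (quo P (pushPt (P * M) L a x k - legOff P a i)) (quo P (pushPt (P * M) L b w k' - legOff P b i')) a b
            else 0)) = T i i' k k' := by
    intro i i' k k'
    simp only [hT]
    rw [ite_and_eq, quo_pushPt_lift P M L a x i k, quo_pushPt_lift P M L b w i' k']
    have e1 := pushInd_lift P M L a x i k
    have e2 := pushInd_lift P M L b w i' k'
    calc pushInd (P * M) L a x * pushInd (P * M) L b w *
          (legW d P a * legW d P b *
            ((if Torus.proj P (pushPt (P * M) L a x k - legOff P a i) = 0 then (1 : ℝ) else 0) *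
                (if Torus.proj P (pushPt (P * M) L b w k' - legOff P b i') = 0 then (1 : ℝ) else 0) *
              K (pushPt M L a (quo P (x - legOff P a i)) k) (pushPt M L b (quo P (w - legOff P b i')) k') a b))
        = legW d P a * legW d P b *
            ((pushInd (P * M) L a x *
                (if Torus.proj P (pushPt (P * M) L a x k - legOff P a i) = 0 then (1 : ℝ) else 0)) *
              (pushInd (P * M) L b w *
                (if Torus.proj P (pushPt (P * M) L b w k' - legOff P b i') = 0 then (1 : ℝ) else 0))) *
            K (pushPt M L a (quo P (x - legOff P a i)) k) (pushPt M L b (quo P (w - legOff P b i')) k') a b := by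
          ring
      _ = _ := by rw [e1, e2]; ring
  -- LHS = Σ_k Σ_k' Σ_i Σ_i' T
  have hL : pushSum (P * M) L (avgLift P K) x w a b =
      ∑ k ∈ pushSet d L a, ∑ k' ∈ pushSet d L b, ∑ i ∈ legSet d P a, ∑ i' ∈ legSet d P b, T i i' k k' := by
    simp only [pushSum, avgLift, Finset.mul_sum]
    exact Finset.sum_congr rfl fun k _ => Finset.sum_congr rfl fun k' _ =>
      Finset.sum_congr rfl fun i _ => Finset.sum_congr rfl fun i' _ => key i i' k k'
  -- RHS = Σ_i Σ_i' Σ_k Σ_k' T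
  have hR : avgLift P (pushSum M L K) x w a b =
      ∑ i ∈ legSet d P a, ∑ i' ∈ legSet d P b, ∑ k ∈ pushSet d L a, ∑ k' ∈ pushSet d L b, T i i' k k' := by
    simp only [avgLift, pushSum, hT]
    refine Finset.sum_congr rfl fun i _ => Finset.sum_congr rfl fun i' _ => ?_
    rw [ite_and_eq]
    simp only [Finset.mul_sum]
  rw [hL, hR]
  calc ∑ k ∈ pushSet d L a, ∑ k' ∈ pushSet d L b, ∑ i ∈ legSet d P a, ∑ i' ∈ legSet d P b, T i i' k k'
      = ∑ k ∈ pushSet d L a, ∑ i ∈ legSet d P a, ∑ i' ∈ legSet d P b, ∑ k' ∈ pushSet d L b, T i i' k k' := by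
        refine Finset.sum_congr rfl fun k _ => ?_
        rw [Finset.sum_comm]
        refine Finset.sum_congr rfl fun i _ => ?_
        rw [Finset.sum_comm]
    _ = _ := by
        rw [Finset.sum_comm]
        refine Finset.sum_congr rfl fun i _ => ?_
        rw [Finset.sum_comm]

/-- [folklore] The commutation with the scale product supplied as an equation (the form used under powers of `Lc`). -/
theorem pushSum_avgLift' {R : ℕ} (hR : R = P * M) (K : MKer (d + 1) (Fib d)) :
    pushSum R L (avgLift P K) = avgLift P (pushSum M L K) := by
  subst hR; exact pushSum_avgLift P M L K

end PushLift

end Summit.QuantumFields.BalabanUV.Beta.GAN24.ScaleNesting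

end
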